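import Mathlib
import HarnessLib
import Summits.NavierStokesRegularity.NavierStokesRegularity.Theorems.UnthreadedRigidityDoorUnthreadedRigidityVirialHornDefs
import Summits.NavierStokesRegularity.NavierStokesRegularity.Theorems.UnthreadedRigidityDoorUnthreadedRigidityThreadingJetsWindowGeneric

/-!
# Route `UnthreadedRigidityDoor`, wall item W2 `UnthreadedRigidity` (stmt-NavierStokesRegularity-27585) — LINE g12-2 «PERSISTENCE FILTER»
# (ns-idea-6 g12, `Persistence_sketch.lean` 09bc8f71301208c4; idea-crit-7 g8 PASS; DIRECTOR-NS #294): support S «CUBIC LAW» (`l = 2`)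
# `CubicLaw`, VERBATIM (the sketch-local `balAmp 2` unfolded)

Seat ns-es-p1 g8 (W2 second queue; announce-before-propose on the ideators bus).

* `cubicLaw` — **`CubicLaw` VERBATIM**: for an admissible profile `H`, analytic on `(0,∞)`, with `b_2[H] = (K H′ − 3K′H)/r ≡ 0` there, ONE constant `C`
  gives `K³ = C·H` on `(0,∞)` (`K = K_2[H]` the vorticity amplitude).  PROOF (CARD §3.5): if `H ≡ 0` on `(0,∞)` then `H′ = H″ = 0` there, `K ≡ 0`, take
  `C = 0`; else at `r₀` with `H(r₀) ≠ 0` put `C := K(r₀)³/H(r₀)`; on an open interval around `r₀` where `H ≠ 0` the quotient `K³/H` has derivative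
  `K²(3K′H − KH′)/H² = 0`, so it is `≡ C` there and `K³ − C·H` vanishes near `r₀`; `K³ − C·H` is analytic on the connected `(0,∞)`
  (`…ThreadingJets.analyticOnNhd_vortAmpL`), hence `≡ 0` (identity theorem).

HONEST LABEL: an elementary ODE support of a files-only rung line; nothing here bears on `UnthreadedRigidity` (27585), the door Target, W2 or Navier–Stokes
regularity; no summit statement is proved.  MODEL/rung work.
-/

noncomputable section

-- the summit and its single sub-problem share the name (CONVENTIONS §1), as in every Theorems file
set_option linter.dupNamespace false

namespace Summit.NavierStokesRegularity.NavierStokesRegularity.Theorems.UnthreadedRigidity.Persistence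

open Set Function Filter Topology
open Summit.NavierStokesRegularity.NavierStokesRegularity.Theorems.UnthreadedRigidity.VirialHorn (VirialAdmissible vortAmpL strainAmpL)
open Summit.NavierStokesRegularity.NavierStokesRegularity.Theorems.UnthreadedRigidity.ThreadingJets
  (virialAdmissible_hasDerivAt_of_pos eq_zero_of_vortAmpL_eq_zero analyticOnNhd_vortAmpL)

/-- If `H ≡ 0` on `(0,∞)` then its vorticity amplitude vanishes there (`H′ = H″ = 0` on the open set). -/
theorem vortAmpL_eq_zero_of_eq_zero {l : ℕ} {H : ℝ → ℝ} (h0 : ∀ r : ℝ, 0 < r → H r = 0) {r : ℝ} (hr : 0 < r) :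
    vortAmpL l H r = 0 := by
  have hH : H =ᶠ[𝓝 r] fun _ => (0 : ℝ) := by
    filter_upwards [Ioi_mem_nhds hr] with s hs
    exact h0 s hs
  have h1 : ∀ s : ℝ, 0 < s → deriv H s = 0 := fun s hs => by
    have hs' : H =ᶠ[𝓝 s] fun _ => (0 : ℝ) := by
      filter_upwards [Ioi_mem_nhds hs] with σ hσ
      exact h0 σ hσ
    rw [hs'.deriv_eq]; simp
  have h1' : deriv H =ᶠ[𝓝 r] fun _ => (0 : ℝ) := by
    filter_upwards [Ioi_mem_nhds hr] with s hs
    exact h1 s hs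
  have h2 : deriv (deriv H) r = 0 := by rw [h1'.deriv_eq]; simp
  unfold vortAmpL
  rw [h2, h1 r hr]; ring

/-- **`CubicLaw` (VERBATIM, the sketch-local `balAmp 2 H r` unfolded)**: `b_2[H] ≡ 0` on `(0,∞)` for an admissible analytic profile gives ONE constant
`C` with `K³ = C·H` on `(0,∞)` (module docstring for the proof). -/
theorem cubicLaw :
    ∀ (H : ℝ → ℝ), VirialAdmissible 2 H → AnalyticOnNhd ℝ H (Set.Ioi 0) →
      (∀ r : ℝ, 0 < r →
        ((2 : ℕ) : ℝ) / (2 * r) * ((((2 : ℕ) : ℝ) - 1) * vortAmpL 2 H r * deriv H r -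
          (((2 : ℕ) : ℝ) + 1) * deriv (vortAmpL 2 H) r * H r) = 0) →
      ∃ C : ℝ, ∀ r : ℝ, 0 < r → vortAmpL 2 H r ^ 3 = C * H r := by
  intro H hH hHa hb
  -- the balance: `K H′ = 3 K′ H` on `(0,∞)`
  have hbal : ∀ r : ℝ, 0 < r → vortAmpL 2 H r * deriv H r = 3 * deriv (vortAmpL 2 H) r * H r := by
    intro r hr
    have h := hb r hr
    have hc : ((2 : ℕ) : ℝ) / (2 * r) ≠ 0 := by
      push_cast; exact div_ne_zero two_ne_zero (by positivity)
    have h2 := (mul_eq_zero.1 h).resolve_left hc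
    push_cast at h2
    linarith
  have hK : AnalyticOnNhd ℝ (vortAmpL 2 H) (Ioi 0) := analyticOnNhd_vortAmpL hHa
  by_cases hHz : ∀ r : ℝ, 0 < r → H r = 0
  · exact ⟨0, fun r hr => by rw [vortAmpL_eq_zero_of_eq_zero hHz hr, hHz r hr]; ring⟩
  push Not at hHz
  obtain ⟨r₀, hr₀, hH0⟩ := hHz
  set C : ℝ := vortAmpL 2 H r₀ ^ 3 / H r₀ with hC
  refine ⟨C, ?_⟩
  -- `F := K³ − C H` is analytic on `(0,∞)` and vanishes near `r₀`
  set F : ℝ → ℝ := fun r => vortAmpL 2 H r ^ 3 - C * H r with hF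
  have hFa : AnalyticOnNhd ℝ F (Ioi 0) := fun r hr => ((hK r hr).pow 3).sub (analyticAt_const.mul (hHa r hr))
  -- an open interval around `r₀` inside `(0,∞)` where `H ≠ 0`
  have hne : ∀ᶠ r in 𝓝 r₀, H r ≠ 0 ∧ 0 < r :=
    ((hHa r₀ hr₀).continuousAt.eventually_ne hH0).and (Ioi_mem_nhds hr₀)
  obtain ⟨ε, hε, hball⟩ := Metric.eventually_nhds_iff.1 hne
  -- on the ball: the quotient `Q = K³/H` has zero derivative
  set Q : ℝ → ℝ := fun r => vortAmpL 2 H r ^ 3 / H r with hQ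
  have hQd : ∀ r, dist r r₀ < ε → HasDerivAt Q 0 r := by
    intro r hr
    obtain ⟨hHr, hr0⟩ := hball hr
    have hKd : HasDerivAt (vortAmpL 2 H) (deriv (vortAmpL 2 H) r) r := (hK r hr0).differentiableAt.hasDerivAt
    have hHd : HasDerivAt H (deriv H r) r := (hHa r hr0).differentiableAt.hasDerivAt
    have hK3 : HasDerivAt (fun s => vortAmpL 2 H s ^ 3) (3 * vortAmpL 2 H r ^ 2 * deriv (vortAmpL 2 H) r) r := by
      have h := hKd.fun_pow 3
      simpa using h
    have hdiv := hK3.div hHd hHr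
    have e : (3 * vortAmpL 2 H r ^ 2 * deriv (vortAmpL 2 H) r * H r - vortAmpL 2 H r ^ 3 * deriv H r) / H r ^ 2 = 0 := by
      rw [div_eq_zero_iff]
      left
      have h1 := hbal r hr0
      have e1 : 3 * vortAmpL 2 H r ^ 2 * deriv (vortAmpL 2 H) r * H r - vortAmpL 2 H r ^ 3 * deriv H r =
          vortAmpL 2 H r ^ 2 * (3 * deriv (vortAmpL 2 H) r * H r - vortAmpL 2 H r * deriv H r) := by ring
      rw [e1, ← h1]; ring
    rw [e] at hdiv
    exact hdiv
  -- hence `Q` is constant on the ball, `= C`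
  have hQdiff : DifferentiableOn ℝ Q (Metric.ball r₀ ε) := fun r hr =>
    (hQd r (Metric.mem_ball.1 hr)).differentiableAt.differentiableWithinAt
  have hQconst : ∀ r ∈ Metric.ball r₀ ε, Q r = Q r₀ := fun r hr =>
    Metric.isOpen_ball.is_const_of_deriv_eq_zero (convex_ball r₀ ε).isPreconnected hQdiff
      (fun x hx => (hQd x (Metric.mem_ball.1 hx)).deriv) hr (Metric.mem_ball_self hε)
  have hF0 : F =ᶠ[𝓝 r₀] 0 := by
    filter_upwards [Metric.ball_mem_nhds r₀ hε] with r hr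
    obtain ⟨hHr, -⟩ := hball (Metric.mem_ball.1 hr)
    have h1 : Q r = C := by rw [hQconst r hr]
    simp only [hF, Pi.zero_apply]
    rw [← h1, hQ]
    field_simp
    ring
  have hFzero := hFa.eqOn_zero_of_preconnected_of_eventuallyEq_zero (convex_Ioi (0 : ℝ)).isPreconnected hr₀ hF0
  intro r hr
  have h := hFzero hr
  simp only [hF, Pi.zero_apply] at h
  linarith

end Summit.NavierStokesRegularity.NavierStokesRegularity.Theorems.UnthreadedRigidity.Persistence

end
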